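import Summits.QuantumFields.YangMills.Theorems.UnitScaleTiltProp8ChartHInvLetter
import HarnessLib

/-!
# BalabanUVNodes ∕ N07 — THE ROUTE's CORRECTED RIGHT INVERSE `H X = H₀X̃′ + dφ` OF THE TRUE LINEARISATION CARRIES EVERY TWISTED (46) LETTER, from a KERNEL ROW of
# `H₀` and the half-rate row sum — part 1 of 2: the Construction-section lemmas (generic carrier `P : Params`)

Cell `pub-ymgap`, width seat `pub-ymgap-dag-n07-w2` generation 4 (HUMAN RULING D-0149; DAG node N07 = [15] = [Balaban1985Variational]; W-SEAT START LIST §n07 item 2 = S2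
«Prop. 3 at objects» — the discharge of the twisted letter DISPLAYED in this seat's `…N07ChartDDecay` ((73) with decay)).  `--kind proof --supports …
--as helper` (K1 face; count-neutral).  SAME OBJECTS as the route `UnitScaleTilt`'s `ChartHInv` (`UnitScaleTiltProp8ChartHInvBridge∕Letter`, seat ym3-torus-p1 g18): corrected
data `X̃′`, end-point correction `κ`, the real kernel `Y = H₀ᴹX̃′`, tents `τ`, gauge function `φ`; CONSUMED BY NAME: `ChartHInv.{norm_combMean_le_of_local, norm_combFamily_le,
tau_eq_zero_of_ne, pin_mem, levOf_endpoints_le_succ}`, `FlatCubeLevels.{levOf_inOm_unique, lamSite_levOf_inOm}`, `iterBlockOf_embIter∕_succ`.  Nothing modified.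

THE PRINT ([15] p. 289, (71)): «A kernel of the operator (I + ℜ)⁻¹ satisfies the bound |(I + ℜ)⁻¹(c, c′)| ≤ (1 − 9C₂B₀ε₃dc₁(½))⁻¹(L^{j′}η)^{−d}e^{−½δ₀d(c₋,c′₋)} … which
follows from Lemma 2.1 [3]» — its input is the exponential decay of the kernel of `H` ((46) with [5] Thm 3.12 ∕ [3] Cor. 2.8; (161) p. 303) and the scale sum `c₁(½)` of
[3] Lemma 2.1 ((162) p. 303).  Here the route's `H` is NOT print's `GQ*(QGQ*)⁻¹` but its comb-corrected version inverting the TRUE linearisation `η·Q^{(j)}`; this file shows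
the correction is LOCAL enough to carry the decay: the corrected datum `X̃′(j,c)` reads `X` at `(j,c)` and at the level-`(j−1)` index bonds inside the blocks of the
end-points of `c` (slack `r₁`), and `dφ` across a fine bond `b` reads `Y` under the territory blocks of the two end-points of `b` (slack `r₂`; territory collar).

THE TWISTS.  `dE : bonds → ℝ`, `dF : 𝔅 → ℝ` («distances to a fixed block»), rate `0 ≤ δ ≤ ½δ₀`, with (s1) the triangle inequality `dE(b) ≤ d(b,c) + dF(c)` against the
bipartite distance `d = dBI ≥ 0` of the kernel row; (s2) INDEX SLACK `dF(i) ≤ dF(c) + r₁` whenever the index bonds `i`, `c` see a common fine site; (s3) BLOCK SLACK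
`dE(b) ≤ dE(b′) + r₂` whenever `b′₋` lies in the `j`-block (`j ≤ k`) of an end-point of `b`.  INPUT ROWS: `|H₀δ_c(b)| ≤ C_K·e^{−δ₀d(b,c)}` (P2's `HKernelRows` (k1),
[3] Cor. 2.8) and `w₁(b)·Σ_c e^{−½δ₀d(b,c)}(L^{j(c)}η)⁻¹ ≤ B₃` ((162), P2's `RowSum162` without the factor `d + 1`).

WHAT IS PROVED (sorry-free; no definition; axioms standard; `C = (d+2)L`, `A = 1 + 2Ce^{δr₁}`).  `norm_Xf_le_twisted`; `norm_kappa_le_twisted` (`‖κ_j(y)‖ ≤ Ce^{δr₁}·t·e^{−δdF(i)}`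
at an end-point `y` of `i`); `norm_Xt_le_twisted` (`‖X̃′(i)‖ ≤ (L^jη)⁻¹A·t·e^{−δdF(i)}`); ★★ `letter_Y_twisted` (`e^{δdE(b)}w₁(b)‖Y(b)‖ ≤ C_KB₃A·t` — kernel row × twisted
data × triangle × half-rate row sum); `norm_Lam_pin_le_twisted`; `norm_dphi_le_twisted`; ★★ `letter_twisted` (`e^{δdE(b)}w₁(b)‖HX(b)‖ ≤ C_KB₃A(1 + 2C(1+L)e^{δr₂})·t` for
`e^{δdF(c)}‖X(c)‖ ≤ t`, under (2.2)-admissibility with `R·M ≥ 1`).  Part 2 (`…N07ChartHInvTwisted`) packages `∃ H` with the identity and all twisted letters.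

HONEST FRAMING: count-neutral helper; finite-sum bookkeeping on the route's kernel-checked construction; the geometric instances of (s1)–(s3) for «distance to a block» and the
record's kernel row are NOT here (next files); nothing of [15] Sects. D–F asserted; stub 1 ∕ K0⁷ ∕ K1⁷ NOT closed; N07 NOT discharged; counts unmoved; one finite T⁴ programme
at fixed ε — NOT continuum ∕ ℝ⁴ ∕ OS ∕ mass gap ∕ Clay: the Yang–Mills mass gap is NOT proved by any of this; R4 closes the conditional rung `BalabanLadder.UV` only.
No `sorry`, no `def`, no `instance`, no `notation`.

References: [15] T. Bałaban, CMP 102 (1985) 277–309 [Balaban1985Variational] ((45)–(46) p.285, (71) p.289, (156)–(157) p.302, (161)–(162) p.303); [3] = [B6] CMP 96 (1984)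
223–250 [Balaban1984PropagatorsII] ((2.1)–(2.4) p.224, (2.20) p.226, Lemma 2.1 p.232, (2.54) p.233, Cor. 2.8 (2.150)–(2.151) p.249); [4] = [B7] CMP 98 (1985) 17–51
[Balaban1985Averaging] ((62) p.28).
-/

noncomputable section

open scoped BigOperators Matrix.Norms.L2Operator

namespace Summit.QuantumFields.YangMills.BalabanUVNodes.N07ChartHInvTwisted

open Literature.MathematicalPhysics.QuantumFieldTheory.Balaban1983to89
open T4Continuum BlockAveraging BlockAveragingEMLLinearised LatticeFieldCalculus
open B5Eq118OneStroke (iterBlockOf iterBlockOf_zero iterBlockOf_succ)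
open B15DeterminingSets (embIter)
open B6SectADomainsV1 (Domains)
open B6SectAOperatorsV1 (BondIdx SiteIdx)
open B11Eq115Space (levOf)
open Summit.QuantumFields.YangMills.Theorems (FlatCubeLevels.levOf_inOm_unique FlatCubeLevels.lamSite_levOf_inOm FlatCubeLevels.levOf_inOm_le)
open Summit.QuantumFields.YangMills.Theorems.FlatCubeOpsText (Adm22)
open Summit.QuantumFields.YangMills.Theorems.Prop8Chart (collar_of_adm22)
open Summit.QuantumFields.YangMills.Theorems.Prop7CombGauge (combMean_add)
open Summit.QuantumFields.YangMills.Theorems.ChartHInv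
open Literature.MathematicalPhysics.QuantumFieldTheory.BalabanImbrieJaffe1984to88.BIJ88RT51Background (iterBlockOf_embIter)

variable {P : Params} {n : Type*}

section Construction

variable (D : Domains P) (η : ℝ)
  (Λ : (i : ℕ) → (PBond P 0 → Matrix n n ℂ) → Site P i → Matrix n n ℂ)
  (hΛ0 : ∀ Y y, Λ 0 Y y = 0)
  (hΛs : ∀ (i : ℕ) (Y : PBond P 0 → Matrix n n ℂ) (y : Site P (i + 1)), Λ (i + 1) Y y = (P.L ^ i : ℕ) • combMean (bondAvgIter i Y) y + Λ i Y (emb y))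
  (Xf : (BondIdx D → Matrix n n ℂ) → (i : ℕ) → PBond P i → Matrix n n ℂ)
  (hXf : ∀ X i b, Xf X i b = if h : D.LamBond i b then X ⟨⟨⟨i, Nat.lt_succ_of_le (D.le_of_lamBond h)⟩, b⟩, h⟩ else 0)
  (κ : (BondIdx D → Matrix n n ℂ) → (j : ℕ) → Site P j → Matrix n n ℂ)
  (hκ0 : ∀ X y, κ X 0 y = 0)
  (hκs : ∀ X (i : ℕ) (y : Site P (i + 1)), κ X (i + 1) y = if y ∈ D.Om (i + 1) then 0 else combMean (Xf X i) y)
  (Xt : (BondIdx D → Matrix n n ℂ) → BondIdx D → Matrix n n ℂ)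
  (hXt : ∀ X idx, Xt X idx = (((P.L : ℝ) ^ (idx.1.1 : ℕ) * η)⁻¹) • (X idx + (κ X idx.1.1 idx.1.2.tgt - κ X idx.1.1 idx.1.2.src)))
  (H₀ : (BondIdx D → ℝ) →ₗ[ℝ] (PBond P 0 → ℝ))
  (Y : (BondIdx D → Matrix n n ℂ) → PBond P 0 → Matrix n n ℂ)
  (hY : ∀ X b, Y X b = ∑ i : BondIdx D, H₀ (Pi.single i 1) b • Xt X i)
  (τ : SiteIdx D → Site P 0 → ℝ)
  (hτ0 : ∀ s x, iterBlockOf (s.1.1 : ℕ) x ≠ s.1.2 → τ s x = 0)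
  (φ : (BondIdx D → Matrix n n ℂ) → Site P 0 → Matrix n n ℂ)
  (hφ : ∀ X x, φ X x = ∑ s : SiteIdx D, τ s x • Λ (s.1.1 : ℕ) (Y X) s.1.2)

section Letter

variable [Fintype n] [DecidableEq n]
  (w₁ : PBond P 0 → ℝ) (hw₁ : ∀ b, w₁ b = (P.L : ℝ) ^ levOf (fun i => {z : Site P 0 | D.InOm i z}) D.k b.src * η)
  (hτlip : ∀ (s : SiteIdx D) (b : PBond P 0), |τ s b.tgt - τ s b.src| ≤ 2 / (P.L : ℝ) ^ (s.1.1 : ℕ))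
  -- the kernel row of `H₀` over a bipartite distance and its row sum at the half rate
  (dBI : PBond P 0 → BondIdx D → ℝ) (hd0 : ∀ b c, 0 ≤ dBI b c) {CK δ₀ B₃ : ℝ} (hCK : 0 ≤ CK)
  (hker : ∀ (c : BondIdx D) (b : PBond P 0), |H₀ (Pi.single c 1) b| ≤ CK * Real.exp (-(δ₀ * dBI b c)))
  (hrow : ∀ b, w₁ b * ∑ c : BondIdx D, Real.exp (-(δ₀ / 2 * dBI b c)) * ((P.L : ℝ) ^ (c.1.1 : ℕ) * η)⁻¹ ≤ B₃)
  -- the twists: «distances to a fixed block» on the fine bonds ∕ index bonds, with their slacks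
  (dE : PBond P 0 → ℝ) (dF : BondIdx D → ℝ) {δ r₁ r₂ : ℝ} (hδ : 0 ≤ δ) (hδh : δ ≤ δ₀ / 2)
  (htri : ∀ b c, dE b ≤ dBI b c + dF c)
  (hF : ∀ (i c : BondIdx D) (x : Site P 0),
    (iterBlockOf (i.1.1 : ℕ) x = i.1.2.src ∨ iterBlockOf (i.1.1 : ℕ) x = i.1.2.tgt) →
    (iterBlockOf (c.1.1 : ℕ) x = c.1.2.src ∨ iterBlockOf (c.1.1 : ℕ) x = c.1.2.tgt) → dF i ≤ dF c + r₁)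
  (hE : ∀ (b b' : PBond P 0) (x : Site P 0) (j : ℕ), (x = b.src ∨ x = b.tgt) → j ≤ D.k →
    iterBlockOf j b'.src = iterBlockOf j x → dE b ≤ dE b' + r₂)

include hXf in
/-- The data read as level fields, twisted: if `e^{δ·dF(c)}‖X(c)‖ ≤ t` then the level-`i` field `Xf X i b′` at a bond is either `0` or the datum of the index `(i, b′)`,
so `‖Xf X i b′‖ ≤ t·e^{−δ·dF(i,b′)}` there. [cite: Balaban1984PropagatorsII, (2.20) p.226] -/
theorem norm_Xf_le_twisted (X : BondIdx D → Matrix n n ℂ) {t : ℝ} (hX : ∀ c, Real.exp (δ * dF c) * ‖X c‖ ≤ t)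
    (i : ℕ) (b : PBond P i) (h : D.LamBond i b) :
    ‖Xf X i b‖ ≤ t * Real.exp (-(δ * dF ⟨⟨⟨i, Nat.lt_succ_of_le (D.le_of_lamBond h)⟩, b⟩, h⟩)) := by
  rw [hXf, dif_pos h, Real.exp_neg, ← div_eq_mul_inv, le_div_iff₀ (Real.exp_pos _), mul_comm]
  exact hX _

include hXf hκ0 hκs hδ hF in
/-- **THE END-POINT CORRECTION, TWISTED**: at an end-point `y` of an index bond `i`, `‖κ_{j}(y)‖ ≤ (d+2)L·e^{δr₁}·t·e^{−δ·dF(i)}` — the comb mean over `B(y)` reads the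
level-`(j−1)` data at index bonds sharing a fine site with `i` (slack `dF(i) ≤ dF(c′) + r₁`). [cite: Balaban1985Averaging, (62) p.28; Balaban1984PropagatorsII, (2.2)-(2.4) p.224] -/
theorem norm_kappa_le_twisted (X : BondIdx D → Matrix n n ℂ) {t : ℝ} (ht : 0 ≤ t) (hX : ∀ c, Real.exp (δ * dF c) * ‖X c‖ ≤ t)
    (idx : BondIdx D) {y : Site P (idx.1.1 : ℕ)} (hy : y = idx.1.2.src ∨ y = idx.1.2.tgt) :
    ‖κ X (idx.1.1 : ℕ) y‖ ≤ ((P.d + 2) * P.L : ℕ) * (Real.exp (δ * r₁) * t * Real.exp (-(δ * dF idx))) := by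
  obtain ⟨⟨⟨j, hjlt⟩, c⟩, hc⟩ := idx
  simp only at hy ⊢
  have hjk : j ≤ P.m + P.K := (Nat.lt_succ_iff.mp hjlt).trans D.hk
  cases j with
  | zero => rw [hκ0, norm_zero]; positivity
  | succ i =>
    rw [hκs]
    split_ifs
    · rw [norm_zero]; positivity
    · refine norm_combMean_le_of_local hjk (Xf X i) y (by positivity) fun b' hbs hbt => ?_
      by_cases hb' : D.LamBond i b'
      · -- the index `c′ = (i, b′)` shares the fine site `embIter i b′₋` with `idx`
        have hx1 : iterBlockOf i (embIter i b'.src) = b'.src := iterBlockOf_embIter i (by omega) b'.src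
        have hx2 : iterBlockOf (i + 1) (embIter i b'.src) = y := by rw [iterBlockOf_succ, hx1, hbs]
        have hslack : dF ⟨⟨⟨i + 1, hjlt⟩, c⟩, hc⟩ ≤ dF ⟨⟨⟨i, Nat.lt_succ_of_le (D.le_of_lamBond hb')⟩, b'⟩, hb'⟩ + r₁ :=
          hF ⟨⟨⟨i + 1, hjlt⟩, c⟩, hc⟩ ⟨⟨⟨i, Nat.lt_succ_of_le (D.le_of_lamBond hb')⟩, b'⟩, hb'⟩ (embIter i b'.src)
            (by rw [hx2]; exact hy) (Or.inl hx1)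
        have h1 := norm_Xf_le_twisted D Xf hXf dF X hX i b' hb'
        refine h1.trans ?_
        rw [mul_comm (Real.exp (δ * r₁)) t, mul_assoc]
        refine mul_le_mul_of_nonneg_left ?_ ht
        rw [← Real.exp_add]
        exact Real.exp_le_exp.mpr (by nlinarith [mul_le_mul_of_nonneg_left hslack hδ])
      · rw [hXf, dif_neg hb', norm_zero]; positivity

include hXf hκ0 hκs hXt hδ hF in
/-- **THE CORRECTED DATA, TWISTED**: `‖X̃′(i)‖ ≤ (L^{j}η)⁻¹·(1 + 2(d+2)Le^{δr₁})·t·e^{−δ·dF(i)}`. [cite: Balaban1985Variational, (156) p.302] -/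
theorem norm_Xt_le_twisted (hη : 0 < η) (X : BondIdx D → Matrix n n ℂ) {t : ℝ} (ht : 0 ≤ t) (hX : ∀ c, Real.exp (δ * dF c) * ‖X c‖ ≤ t)
    (idx : BondIdx D) :
    ‖Xt X idx‖ ≤ (((P.L : ℝ) ^ (idx.1.1 : ℕ) * η)⁻¹) * ((1 + 2 * ((P.d + 2) * P.L : ℕ) * Real.exp (δ * r₁)) * (t * Real.exp (-(δ * dF idx)))) := by
  have hpos : 0 < ((P.L : ℝ) ^ (idx.1.1 : ℕ) * η)⁻¹ := by have := P.L_pos; positivity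
  rw [hXt, norm_smul, Real.norm_eq_abs, abs_of_pos hpos]
  refine mul_le_mul_of_nonneg_left ?_ hpos.le
  have h1 := norm_kappa_le_twisted D Xf hXf κ hκ0 hκs dF hδ hF X ht hX idx (Or.inr rfl)
  have h2 := norm_kappa_le_twisted D Xf hXf κ hκ0 hκs dF hδ hF X ht hX idx (Or.inl rfl)
  have h0 : ‖X idx‖ ≤ t * Real.exp (-(δ * dF idx)) := by
    rw [Real.exp_neg, ← div_eq_mul_inv, le_div_iff₀ (Real.exp_pos _), mul_comm]; exact hX idx
  calc ‖X idx + (κ X _ idx.1.2.tgt - κ X _ idx.1.2.src)‖ ≤ ‖X idx‖ + (‖κ X _ idx.1.2.tgt‖ + ‖κ X _ idx.1.2.src‖) :=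
        (norm_add_le _ _).trans (add_le_add le_rfl (norm_sub_le _ _))
    _ ≤ t * Real.exp (-(δ * dF idx)) + (((P.d + 2) * P.L : ℕ) * (Real.exp (δ * r₁) * t * Real.exp (-(δ * dF idx))) +
          ((P.d + 2) * P.L : ℕ) * (Real.exp (δ * r₁) * t * Real.exp (-(δ * dF idx)))) := add_le_add h0 (add_le_add h1 h2)
    _ = (1 + 2 * ((P.d + 2) * P.L : ℕ) * Real.exp (δ * r₁)) * (t * Real.exp (-(δ * dF idx))) := by ring

include hXf hκ0 hκs hXt hY hw₁ hd0 hCK hker hrow hδ hδh htri hF in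
/-- **THE TWISTED LETTER OF `Y = H₀ᴹX̃′`**: `e^{δ·dE(b)}·w₁(b)·‖Y(b)‖ ≤ C_K·B₃·(1 + 2(d+2)Le^{δr₁})·t` for data with `e^{δ·dF(c)}‖X(c)‖ ≤ t` — the kernel row of `H₀`
(rate `δ₀`), the twisted size of `X̃′`, the triangle inequality `dE(b) ≤ d(b,c) + dF(c)` and the half-rate row sum ([3] Lemma 2.1 ∕ (162)).
[cite: Balaban1985Variational, (46) p.285, (161)-(162) p.303; Balaban1984PropagatorsII, Lemma 2.1 p.232, (2.54) p.233] -/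
theorem letter_Y_twisted (hη : 0 < η) (X : BondIdx D → Matrix n n ℂ) {t : ℝ} (ht : 0 ≤ t) (hX : ∀ c, Real.exp (δ * dF c) * ‖X c‖ ≤ t) (b : PBond P 0) :
    Real.exp (δ * dE b) * (w₁ b * ‖Y X b‖) ≤ CK * B₃ * (1 + 2 * ((P.d + 2) * P.L : ℕ) * Real.exp (δ * r₁)) * t := by
  classical
  set A : ℝ := 1 + 2 * ((P.d + 2) * P.L : ℕ) * Real.exp (δ * r₁) with hA
  have hA0 : 0 ≤ A := by positivity
  have hL0 : (0 : ℝ) < P.L := by exact_mod_cast P.L_pos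
  have hw0 : 0 ≤ w₁ b := by rw [hw₁]; positivity
  have hwinv : ∀ i : BondIdx D, 0 < ((P.L : ℝ) ^ (i.1.1 : ℕ) * η)⁻¹ := fun i => by positivity
  -- `‖Y X b‖ ≤ Σ_i |K(b,i)|·‖X̃′(i)‖`
  have h1 : ‖Y X b‖ ≤ ∑ i, CK * Real.exp (-(δ₀ * dBI b i)) * ((((P.L : ℝ) ^ (i.1.1 : ℕ) * η)⁻¹) * (A * (t * Real.exp (-(δ * dF i))))) := by
    rw [hY]
    refine (norm_sum_le _ _).trans (Finset.sum_le_sum fun i _ => ?_)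
    rw [norm_smul, Real.norm_eq_abs]
    exact mul_le_mul (hker i b) (norm_Xt_le_twisted D η Xf hXf κ hκ0 hκs Xt hXt dF hδ hF hη X ht hX i) (norm_nonneg _) (by positivity)
  -- each term after the twist: `e^{δdE(b)}·e^{−δ₀d}·e^{−δdF(i)} ≤ e^{−½δ₀d}`
  have hterm : ∀ i : BondIdx D, Real.exp (δ * dE b) * (CK * Real.exp (-(δ₀ * dBI b i)) * ((((P.L : ℝ) ^ (i.1.1 : ℕ) * η)⁻¹) * (A * (t * Real.exp (-(δ * dF i)))))) ≤
      CK * A * t * (Real.exp (-(δ₀ / 2 * dBI b i)) * (((P.L : ℝ) ^ (i.1.1 : ℕ) * η)⁻¹)) := by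
    intro i
    have hexp : Real.exp (δ * dE b) * Real.exp (-(δ₀ * dBI b i)) * Real.exp (-(δ * dF i)) ≤ Real.exp (-(δ₀ / 2 * dBI b i)) := by
      rw [← Real.exp_add, ← Real.exp_add]
      apply Real.exp_le_exp.mpr
      have h3 := mul_le_mul_of_nonneg_left (htri b i) hδ
      have h4 := mul_le_mul_of_nonneg_right hδh (hd0 b i)
      nlinarith
    calc Real.exp (δ * dE b) * (CK * Real.exp (-(δ₀ * dBI b i)) * ((((P.L : ℝ) ^ (i.1.1 : ℕ) * η)⁻¹) * (A * (t * Real.exp (-(δ * dF i))))))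
        = CK * A * t * ((Real.exp (δ * dE b) * Real.exp (-(δ₀ * dBI b i)) * Real.exp (-(δ * dF i))) * (((P.L : ℝ) ^ (i.1.1 : ℕ) * η)⁻¹)) := by ring
      _ ≤ CK * A * t * (Real.exp (-(δ₀ / 2 * dBI b i)) * (((P.L : ℝ) ^ (i.1.1 : ℕ) * η)⁻¹)) :=
          mul_le_mul_of_nonneg_left (mul_le_mul_of_nonneg_right hexp (hwinv i).le) (by positivity)
  calc Real.exp (δ * dE b) * (w₁ b * ‖Y X b‖)
      ≤ Real.exp (δ * dE b) * (w₁ b * ∑ i, CK * Real.exp (-(δ₀ * dBI b i)) * ((((P.L : ℝ) ^ (i.1.1 : ℕ) * η)⁻¹) * (A * (t * Real.exp (-(δ * dF i)))))) :=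
        mul_le_mul_of_nonneg_left (mul_le_mul_of_nonneg_left h1 hw0) (Real.exp_pos _).le
    _ = w₁ b * ∑ i, Real.exp (δ * dE b) * (CK * Real.exp (-(δ₀ * dBI b i)) * ((((P.L : ℝ) ^ (i.1.1 : ℕ) * η)⁻¹) * (A * (t * Real.exp (-(δ * dF i)))))) := by
        simp only [Finset.mul_sum]
        exact Finset.sum_congr rfl fun i _ => by ring
    _ ≤ w₁ b * ∑ i, CK * A * t * (Real.exp (-(δ₀ / 2 * dBI b i)) * (((P.L : ℝ) ^ (i.1.1 : ℕ) * η)⁻¹)) :=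
        mul_le_mul_of_nonneg_left (Finset.sum_le_sum fun i _ => hterm i) hw0
    _ = CK * A * t * (w₁ b * ∑ i, Real.exp (-(δ₀ / 2 * dBI b i)) * (((P.L : ℝ) ^ (i.1.1 : ℕ) * η)⁻¹)) := by
        rw [← Finset.mul_sum]; ring
    _ ≤ CK * A * t * B₃ := mul_le_mul_of_nonneg_left (hrow b) (by positivity)
    _ = CK * B₃ * A * t := by ring

include hΛ0 hΛs hXf hκ0 hκs hXt hY hw₁ hd0 hCK hker hrow hδ hδh htri hF hE in
/-- **LOCAL SIZE OF THE PINNED VALUES, TWISTED**: at the site index `s = (j, y)` pinning an end-point `x` of the fine bond `b` (`Bʲ(x) = y`),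
`‖Λ_j(Y)(y)‖ ≤ (d+2)L·Lʲ·C_KB₃A·e^{δr₂}·t·e^{−δ·dE(b)}∕(Lʲη)` — inside `Bʲ(y)` every fine bond has territory `j` and lies within the slack `r₂` of `b`.
[cite: Balaban1985Variational, (46) p.285; Balaban1985Averaging, (62) p.28] -/
theorem norm_Lam_pin_le_twisted (hη : 0 < η) (hB₃ : 0 ≤ B₃) (X : BondIdx D → Matrix n n ℂ) {t : ℝ} (ht : 0 ≤ t)
    (hX : ∀ c, Real.exp (δ * dF c) * ‖X c‖ ≤ t) (b : PBond P 0) (x : Site P 0) (hx : x = b.src ∨ x = b.tgt)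
    (s : SiteIdx D) (hs : iterBlockOf (s.1.1 : ℕ) x = s.1.2) :
    ‖Λ (s.1.1 : ℕ) (Y X) s.1.2‖ ≤ ((P.d + 2) * P.L : ℕ) * (P.L : ℝ) ^ (s.1.1 : ℕ) *
      (CK * B₃ * (1 + 2 * ((P.d + 2) * P.L : ℕ) * Real.exp (δ * r₁)) * t * Real.exp (δ * r₂) * Real.exp (-(δ * dE b)) /
        ((P.L : ℝ) ^ (s.1.1 : ℕ) * η)) := by
  have hj : (s.1.1 : ℕ) ≤ P.m + P.K := (D.le_of_lamSite s.2).trans D.hk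
  have hjk : (s.1.1 : ℕ) ≤ D.k := D.le_of_lamSite s.2
  have hwpos : 0 < (P.L : ℝ) ^ (s.1.1 : ℕ) * η := by have := P.L_pos; positivity
  refine norm_combFamily_le Λ hΛ0 hΛs hj (Y X) s.1.2 (by positivity) fun b' hbs _ => ?_
  have hlev : levOf (fun i => {z : Site P 0 | D.InOm i z}) D.k b'.src = (s.1.1 : ℕ) :=
    FlatCubeLevels.levOf_inOm_unique D (by rw [hbs]; exact s.2)
  have hl := letter_Y_twisted D η Xf hXf κ hκ0 hκs Xt hXt H₀ Y hY w₁ hw₁ dBI hd0 hCK hker hrow dE dF hδ hδh htri hF hη X ht hX b'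
  rw [hw₁, hlev] at hl
  -- the slack: `dE b ≤ dE b′ + r₂`
  have hsl : dE b ≤ dE b' + r₂ := hE b b' x (s.1.1 : ℕ) hx hjk (by rw [hbs, hs])
  have hexp : Real.exp (-(δ * dE b')) ≤ Real.exp (δ * r₂) * Real.exp (-(δ * dE b)) := by
    rw [← Real.exp_add]; exact Real.exp_le_exp.mpr (by nlinarith [mul_le_mul_of_nonneg_left hsl hδ])
  rw [le_div_iff₀ hwpos]
  have hb'pos : 0 < Real.exp (δ * dE b') := Real.exp_pos _
  -- `‖Y X b′‖·(Lʲη) ≤ C_KB₃A·t·e^{−δdE(b′)} ≤ C_KB₃A·t·e^{δr₂}e^{−δdE(b)}`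
  have h1 : ‖Y X b'‖ * ((P.L : ℝ) ^ (s.1.1 : ℕ) * η) ≤
      CK * B₃ * (1 + 2 * ((P.d + 2) * P.L : ℕ) * Real.exp (δ * r₁)) * t * Real.exp (-(δ * dE b')) := by
    rw [Real.exp_neg, ← div_eq_mul_inv, le_div_iff₀ hb'pos]
    calc ‖Y X b'‖ * ((P.L : ℝ) ^ (s.1.1 : ℕ) * η) * Real.exp (δ * dE b') = Real.exp (δ * dE b') * ((P.L : ℝ) ^ (s.1.1 : ℕ) * η * ‖Y X b'‖) := by ring
      _ ≤ _ := hl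
  refine h1.trans ?_
  have h0 : 0 ≤ CK * B₃ * (1 + 2 * ((P.d + 2) * P.L : ℕ) * Real.exp (δ * r₁)) * t := by positivity
  calc CK * B₃ * (1 + 2 * ((P.d + 2) * P.L : ℕ) * Real.exp (δ * r₁)) * t * Real.exp (-(δ * dE b'))
      ≤ CK * B₃ * (1 + 2 * ((P.d + 2) * P.L : ℕ) * Real.exp (δ * r₁)) * t * (Real.exp (δ * r₂) * Real.exp (-(δ * dE b))) :=
        mul_le_mul_of_nonneg_left hexp h0
    _ = _ := by ring

include hΛ0 hΛs hXf hκ0 hκs hXt hY hτ0 hφ hw₁ hτlip hd0 hCK hker hrow hδ hδh htri hF hE in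
/-- **THE GAUGE PART, TWISTED**: `‖φ(b₊) − φ(b₋)‖ ≤ 2(d+2)L·C_KB₃A·e^{δr₂}·t·e^{−δ·dE(b)}·((L^{j₋}η)⁻¹ + (L^{j₊}η)⁻¹)` (only the two tents of the end-points'
territories move across `b`, slope `2∕Lʲ`). [cite: Balaban1985Variational, (46) p.285] -/
theorem norm_dphi_le_twisted (hη : 0 < η) (hB₃ : 0 ≤ B₃) (X : BondIdx D → Matrix n n ℂ) {t : ℝ} (ht : 0 ≤ t)
    (hX : ∀ c, Real.exp (δ * dF c) * ‖X c‖ ≤ t) (b : PBond P 0) :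
    ‖φ X b.tgt - φ X b.src‖ ≤
      2 * ((P.d + 2) * P.L : ℕ) * (CK * B₃ * (1 + 2 * ((P.d + 2) * P.L : ℕ) * Real.exp (δ * r₁)) * t * Real.exp (δ * r₂) * Real.exp (-(δ * dE b))) *
        ((((P.L : ℝ) ^ levOf (fun i => {z : Site P 0 | D.InOm i z}) D.k b.src * η)⁻¹) +
          (((P.L : ℝ) ^ levOf (fun i => {z : Site P 0 | D.InOm i z}) D.k b.tgt * η)⁻¹)) := by
  classical
  set C : ℝ := (((P.d + 2) * P.L : ℕ) : ℝ) with hC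
  set t₁ : ℝ := CK * B₃ * (1 + 2 * ((P.d + 2) * P.L : ℕ) * Real.exp (δ * r₁)) * t * Real.exp (δ * r₂) * Real.exp (-(δ * dE b)) with ht₁
  have ht₁0 : 0 ≤ t₁ := by positivity
  -- the pins of the two end-points
  set p₁ : SiteIdx D := ⟨⟨⟨levOf (fun i => {z : Site P 0 | D.InOm i z}) D.k b.src, pin_mem D b.src⟩,
      iterBlockOf (levOf (fun i => {z : Site P 0 | D.InOm i z}) D.k b.src) b.src⟩, FlatCubeLevels.lamSite_levOf_inOm D b.src⟩ with hp₁
  set p₂ : SiteIdx D := ⟨⟨⟨levOf (fun i => {z : Site P 0 | D.InOm i z}) D.k b.tgt, pin_mem D b.tgt⟩,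
      iterBlockOf (levOf (fun i => {z : Site P 0 | D.InOm i z}) D.k b.tgt) b.tgt⟩, FlatCubeLevels.lamSite_levOf_inOm D b.tgt⟩ with hp₂
  set f : SiteIdx D → ℝ := fun s => |τ s b.tgt - τ s b.src| * ‖Λ (s.1.1 : ℕ) (Y X) s.1.2‖ with hf
  have hf0 : ∀ s, 0 ≤ f s := fun s => by positivity
  have hfzero : ∀ s, s ≠ p₁ → s ≠ p₂ → f s = 0 := by
    intro s h1 h2
    simp only [hf]
    rw [tau_eq_zero_of_ne D τ hτ0 b.tgt s h2, tau_eq_zero_of_ne D τ hτ0 b.src s h1, sub_zero, abs_zero, zero_mul]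
  have hfle : ∀ s, f s ≤ (if s = p₁ then f p₁ else 0) + (if s = p₂ then f p₂ else 0) := by
    intro s
    by_cases h1 : s = p₁
    · subst h1; simp only [if_true]; split_ifs <;> linarith [hf0 p₂]
    · by_cases h2 : s = p₂
      · subst h2; simp only [if_true, if_neg h1]; linarith
      · rw [hfzero s h1 h2, if_neg h1, if_neg h2, add_zero]
  -- the bound on one pin term
  have hpin : ∀ (x : Site P 0), (x = b.src ∨ x = b.tgt) → f ⟨⟨⟨levOf (fun i => {z : Site P 0 | D.InOm i z}) D.k x, pin_mem D x⟩,
      iterBlockOf (levOf (fun i => {z : Site P 0 | D.InOm i z}) D.k x) x⟩, FlatCubeLevels.lamSite_levOf_inOm D x⟩ ≤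
      2 * C * t₁ * (((P.L : ℝ) ^ levOf (fun i => {z : Site P 0 | D.InOm i z}) D.k x * η)⁻¹) := by
    intro x hx
    set j := levOf (fun i => {z : Site P 0 | D.InOm i z}) D.k x with hj
    have hLj : 0 < (P.L : ℝ) ^ j := by have := P.L_pos; positivity
    have hwpos : 0 < (P.L : ℝ) ^ j * η := by positivity
    have hΛ := norm_Lam_pin_le_twisted D η Λ hΛ0 hΛs Xf hXf κ hκ0 hκs Xt hXt H₀ Y hY w₁ hw₁ dBI hd0 hCK hker hrow dE dF hδ hδh htri hF hE
      hη hB₃ X ht hX b x hx ⟨⟨⟨j, pin_mem D x⟩, iterBlockOf j x⟩, FlatCubeLevels.lamSite_levOf_inOm D x⟩ rfl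
    have hτ := hτlip ⟨⟨⟨j, pin_mem D x⟩, iterBlockOf j x⟩, FlatCubeLevels.lamSite_levOf_inOm D x⟩ b
    simp only at hΛ hτ
    simp only [hf]
    calc |τ _ b.tgt - τ _ b.src| * ‖Λ j (Y X) (iterBlockOf j x)‖
        ≤ (2 / (P.L : ℝ) ^ j) * (C * (P.L : ℝ) ^ j * (t₁ / ((P.L : ℝ) ^ j * η))) :=
          mul_le_mul hτ hΛ (norm_nonneg _) (by positivity)
      _ = 2 * C * t₁ * (((P.L : ℝ) ^ j * η)⁻¹) := by field_simp
  -- assemble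
  have hdiff : φ X b.tgt - φ X b.src = ∑ s : SiteIdx D, (τ s b.tgt - τ s b.src) • Λ (s.1.1 : ℕ) (Y X) s.1.2 := by
    rw [hφ, hφ, ← Finset.sum_sub_distrib]
    refine Finset.sum_congr rfl fun s _ => ?_
    rw [sub_smul]
  rw [hdiff]
  calc ‖∑ s : SiteIdx D, (τ s b.tgt - τ s b.src) • Λ (s.1.1 : ℕ) (Y X) s.1.2‖ ≤ ∑ s, f s := by
        refine (norm_sum_le _ _).trans (Finset.sum_le_sum fun s _ => ?_)
        rw [norm_smul, Real.norm_eq_abs]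
    _ ≤ ∑ s, ((if s = p₁ then f p₁ else 0) + (if s = p₂ then f p₂ else 0)) := Finset.sum_le_sum fun s _ => hfle s
    _ = f p₁ + f p₂ := by rw [Finset.sum_add_distrib, Finset.sum_ite_eq' Finset.univ p₁, Finset.sum_ite_eq' Finset.univ p₂]; simp
    _ ≤ 2 * C * t₁ * (((P.L : ℝ) ^ levOf (fun i => {z : Site P 0 | D.InOm i z}) D.k b.src * η)⁻¹) +
          2 * C * t₁ * (((P.L : ℝ) ^ levOf (fun i => {z : Site P 0 | D.InOm i z}) D.k b.tgt * η)⁻¹) :=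
        add_le_add (hpin b.src (Or.inl rfl)) (hpin b.tgt (Or.inr rfl))
    _ = _ := by ring

include hΛ0 hΛs hXf hκ0 hκs hXt hY hτ0 hφ hw₁ hτlip hd0 hCK hker hrow hδ hδh htri hF hE in
/-- ★★ **THE TWISTED LETTER OF `H X = Y + dφ`**: under (2.2)-admissibility with `R·M ≥ 1` (territory collar), for data with `e^{δ·dF(c)}‖X(c)‖ ≤ t`:
`e^{δ·dE(b)}·w₁(b)·‖HX(b)‖ ≤ C_KB₃(1 + 2Ce^{δr₁})(1 + 2C(1+L)e^{δr₂})·t`, `C = (d+2)L` — k-UNIFORM; at `δ = 0` this is the weighted sup letter from the kernel row.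
[cite: Balaban1985Variational, (46) p.285, (71) p.289, (161)-(162) p.303; Balaban1984PropagatorsII, Lemma 2.1 p.232] -/
theorem letter_twisted {R M : ℕ} (hAdm : Adm22 D R M) (hRM : 1 ≤ R * M) (hη : 0 < η) (hB₃ : 0 ≤ B₃)
    (Hf : (BondIdx D → Matrix n n ℂ) → PBond P 0 → Matrix n n ℂ) (hHf : ∀ X b, Hf X b = Y X b + (φ X b.tgt - φ X b.src))
    (X : BondIdx D → Matrix n n ℂ) {t : ℝ} (ht : 0 ≤ t) (hX : ∀ c, Real.exp (δ * dF c) * ‖X c‖ ≤ t) (b : PBond P 0) :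
    Real.exp (δ * dE b) * (w₁ b * ‖Hf X b‖) ≤
      CK * B₃ * (1 + 2 * ((P.d + 2) * P.L : ℕ) * Real.exp (δ * r₁)) *
        (1 + 2 * ((P.d + 2) * P.L : ℕ) * (1 + P.L) * Real.exp (δ * r₂)) * t := by
  set C : ℝ := (((P.d + 2) * P.L : ℕ) : ℝ) with hC
  set T₁ : ℝ := CK * B₃ * (1 + 2 * ((P.d + 2) * P.L : ℕ) * Real.exp (δ * r₁)) * t with hT₁
  have hT₁0 : 0 ≤ T₁ := by positivity
  set j₁ := levOf (fun i => {z : Site P 0 | D.InOm i z}) D.k b.src with hj₁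
  set j₂ := levOf (fun i => {z : Site P 0 | D.InOm i z}) D.k b.tgt with hj₂
  have hL1 : (1 : ℝ) ≤ P.L := by exact_mod_cast P.L_pos
  have hL0 : (0 : ℝ) < P.L := by positivity
  have hw : w₁ b = (P.L : ℝ) ^ j₁ * η := hw₁ b
  have hw0 : 0 ≤ w₁ b := by rw [hw]; positivity
  have he0 : 0 < Real.exp (δ * dE b) := Real.exp_pos _
  have hY' := letter_Y_twisted D η Xf hXf κ hκ0 hκs Xt hXt H₀ Y hY w₁ hw₁ dBI hd0 hCK hker hrow dE dF hδ hδh htri hF hη X ht hX b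
  have hφ' := norm_dphi_le_twisted D η Λ hΛ0 hΛs Xf hXf κ hκ0 hκs Xt hXt H₀ Y hY τ hτ0 φ hφ w₁ hw₁ hτlip dBI hd0 hCK hker hrow dE dF hδ hδh htri hF hE
    hη hB₃ X ht hX b
  -- the collar: `j₁ ≤ j₂ + 1`
  have hlev := (levOf_endpoints_le_succ D hAdm hRM b).1
  have hratio : (P.L : ℝ) ^ j₁ * (((P.L : ℝ) ^ j₂ * η)⁻¹ * η) ≤ P.L := by
    rw [mul_inv, mul_assoc, inv_mul_cancel₀ hη.ne', mul_one, ← div_eq_mul_inv, div_le_iff₀ (by positivity), ← pow_succ']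
    exact pow_le_pow_right₀ hL1 hlev
  have hself : (P.L : ℝ) ^ j₁ * η * (((P.L : ℝ) ^ j₁ * η)⁻¹) = 1 := mul_inv_cancel₀ (by positivity)
  have hee : Real.exp (δ * dE b) * Real.exp (-(δ * dE b)) = 1 := by rw [← Real.exp_add, add_neg_cancel, Real.exp_zero]
  -- the gauge part after the twist: the factors `e^{±δdE(b)}` cancel
  have hφ'' : Real.exp (δ * dE b) * (w₁ b * ‖φ X b.tgt - φ X b.src‖) ≤ 2 * C * (T₁ * Real.exp (δ * r₂)) * (1 + P.L) := by
    calc Real.exp (δ * dE b) * (w₁ b * ‖φ X b.tgt - φ X b.src‖)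
        ≤ Real.exp (δ * dE b) * (w₁ b * (2 * C * (T₁ * Real.exp (δ * r₂) * Real.exp (-(δ * dE b))) *
            ((((P.L : ℝ) ^ j₁ * η)⁻¹) + (((P.L : ℝ) ^ j₂ * η)⁻¹)))) := by
          refine mul_le_mul_of_nonneg_left (mul_le_mul_of_nonneg_left ?_ hw0) he0.le
          have := hφ'; simp only [hT₁, hC] at this ⊢; convert this using 2
      _ = 2 * C * (T₁ * Real.exp (δ * r₂)) * (Real.exp (δ * dE b) * Real.exp (-(δ * dE b))) *
            ((P.L : ℝ) ^ j₁ * η * (((P.L : ℝ) ^ j₁ * η)⁻¹) + (P.L : ℝ) ^ j₁ * (((P.L : ℝ) ^ j₂ * η)⁻¹ * η)) := by rw [hw]; ring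
      _ ≤ 2 * C * (T₁ * Real.exp (δ * r₂)) * (1 + P.L) := by
          rw [hee, hself, mul_one]
          have : 0 ≤ 2 * C * (T₁ * Real.exp (δ * r₂)) := by positivity
          nlinarith [hratio]
  calc Real.exp (δ * dE b) * (w₁ b * ‖Hf X b‖)
      ≤ Real.exp (δ * dE b) * (w₁ b * (‖Y X b‖ + ‖φ X b.tgt - φ X b.src‖)) := by
        rw [hHf]; exact mul_le_mul_of_nonneg_left (mul_le_mul_of_nonneg_left (norm_add_le _ _) hw0) he0.le
    _ = Real.exp (δ * dE b) * (w₁ b * ‖Y X b‖) + Real.exp (δ * dE b) * (w₁ b * ‖φ X b.tgt - φ X b.src‖) := by ring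
    _ ≤ T₁ + 2 * C * (T₁ * Real.exp (δ * r₂)) * (1 + P.L) := add_le_add hY' hφ''
    _ = _ := by rw [hT₁, hC]; ring

end Letter

end Construction

end Summit.QuantumFields.YangMills.BalabanUVNodes.N07ChartHInvTwisted

end
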